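import Summits.NavierStokesRegularity.NavierStokesRegularity.Theorems.CoriolisHeadLocalEnergyPhysicalField
import HarnessLib

/-!
# CoriolisHeadScaleNaturalDecayTools — crux `NoCoRotatingCore` (stmt-NavierStokesRegularity-22676), REGISTERED line
# `far_field_constancy` v2 (skeleton 15c9a82ad206), stub K1a `stub_scaleNaturalDecay` — file 1: calculus of the transfers

Pure calculus for the scale-natural derivative decay `‖y‖‖DU(y)‖ + ‖y‖²‖D²U(y)‖ → 0` of a profile `U`:

* `norm_iteratedFDeriv_comp_affine_le` — `‖Dⁱ[L ∘ f ∘ (A· + v)](y)‖ ≤ ‖L‖‖A‖ⁱ‖Dⁱf(Ay + v)‖` for continuous linear `L, A`;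
* `norm_iteratedFDeriv_profile_le` — the profile read off its PHYSICAL field: `U(y) = λ⁻¹e^{−θB}u(t, λ⁻¹e^{θB}y)`, hence
  `‖DⁱU(y)‖ ≤ λ^{−(i+1)} ‖Dⁱu(t)(λ⁻¹e^{θB}y)‖` (`e^{±θB}` are isometries for skew `B`);
* `derivDecay_translate`, `derivDecay_dilate` — the decay `‖DU(y)‖ ≤ C‖y‖⁻²`, `‖D²U(y)‖ ≤ C‖y‖⁻³` beyond a radius survives the
  symmetries `U ↦ U(· − y₀) + b` and `U ↦ kU(c·)` of the profile system (with new constants);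
* `scaleNaturalDecay_of_derivDecay` — and implies the `ε`–`R` form of K1a.

HONEST FRAMING.  Tools for the registered stub K1a; nothing here proves `NoCoRotatingCore` or NS regularity.

References: H. Koch, N. Nadirashvili, G. Seregin, V. Šverák, Acta Math. 203 (2009) §4 [KochNadirashviliSereginSverak2009]; line
card `Cruxes/NoCoRotatingCore/Lines/far_field_constancy.md` (K1a).
-/

noncomputable section

open MeasureTheory Set Function Filter Topology Metric InnerProductSpace Real
open scoped RealInnerProductSpace Laplacian ContDiff Topology

-- the summit and its single sub-problem share the name (CONVENTIONS §1), as in every Theorems file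
set_option linter.dupNamespace false
-- nested operator types `ℝ³ →L[ℝ] ℝ³` inside the Banach algebra `ℝ³ →L[ℝ] ℝ³` (as in `CoriolisHeadTypeIRateTransport`)
set_option maxSynthPendingDepth 3

namespace Summit.NavierStokesRegularity.NavierStokesRegularity.Theorems.CoriolisHead

namespace ScaleNaturalDecay

open Literature.Analysis.FluidPDE

/-! ## §1 Iterated derivatives under affine-linear conjugation -/

/-- **Iterated derivatives under affine-linear conjugation**: for `f ∈ Cⁿ`, continuous linear `L, A`, a vector `v` and
`i ≤ n`, `‖Dⁱ[y ↦ L(f(Ay + v))](y)‖ ≤ ‖L‖ ‖A‖ⁱ ‖Dⁱf(Ay + v)‖`. [folklore] -/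
theorem norm_iteratedFDeriv_comp_affine_le {f : EuclideanSpace ℝ (Fin 3) → EuclideanSpace ℝ (Fin 3)} {n : ℕ}
    (hf : ContDiff ℝ n f) (L A : EuclideanSpace ℝ (Fin 3) →L[ℝ] EuclideanSpace ℝ (Fin 3)) (v : EuclideanSpace ℝ (Fin 3))
    {i : ℕ} (hi : i ≤ n) (y : EuclideanSpace ℝ (Fin 3)) :
    ‖iteratedFDeriv ℝ i (fun y => L (f (A y + v))) y‖ ≤ ‖L‖ * ‖A‖ ^ i * ‖iteratedFDeriv ℝ i f (A y + v)‖ := by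
  have hfv : ContDiff ℝ n (fun z => f (z + v)) := hf.comp (contDiff_id.add contDiff_const)
  have hg : ContDiff ℝ n (fun y => f (A y + v)) := hfv.comp A.contDiff
  -- the inner composition
  have h1 : ‖iteratedFDeriv ℝ i (fun y => f (A y + v)) y‖ ≤ ‖A‖ ^ i * ‖iteratedFDeriv ℝ i f (A y + v)‖ := by
    have e : (fun y => f (A y + v)) = (fun z => f (z + v)) ∘ A := rfl
    rw [e, ContinuousLinearMap.iteratedFDeriv_comp_right A hfv y (by exact_mod_cast hi), iteratedFDeriv_comp_add_right]
    refine (ContinuousMultilinearMap.norm_compContinuousLinearMap_le _ _).trans (le_of_eq ?_)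
    rw [Finset.prod_const, Finset.card_univ, Fintype.card_fin, mul_comm]
  -- the outer linear map
  have h2 : ‖iteratedFDeriv ℝ i (fun y => L (f (A y + v))) y‖ ≤ ‖L‖ * ‖iteratedFDeriv ℝ i (fun y => f (A y + v)) y‖ := by
    have e : (fun y => L (f (A y + v))) = L ∘ (fun y => f (A y + v)) := rfl
    rw [e]
    exact L.norm_iteratedFDeriv_comp_left (hg.contDiffAt) (by exact_mod_cast hi)
  calc ‖iteratedFDeriv ℝ i (fun y => L (f (A y + v))) y‖ ≤ ‖L‖ * ‖iteratedFDeriv ℝ i (fun y => f (A y + v)) y‖ := h2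
    _ ≤ ‖L‖ * (‖A‖ ^ i * ‖iteratedFDeriv ℝ i f (A y + v)‖) := mul_le_mul_of_nonneg_left h1 (norm_nonneg _)
    _ = ‖L‖ * ‖A‖ ^ i * ‖iteratedFDeriv ℝ i f (A y + v)‖ := by ring

/-- The operator norm of `c • e^{sB}` is at most `|c|` for skew `B`. [folklore] -/
theorem opNorm_smul_exp_le {B : EuclideanSpace ℝ (Fin 3) →L[ℝ] EuclideanSpace ℝ (Fin 3)} (hB : ∀ x, inner ℝ (B x) x = 0)
    (c s : ℝ) : ‖c • NormedSpace.exp (s • B)‖ ≤ |c| := by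
  refine ContinuousLinearMap.opNorm_le_bound _ (abs_nonneg _) fun v => ?_
  have e : (c • NormedSpace.exp (s • B)) v = c • NormedSpace.exp (s • B) v := rfl
  rw [e, norm_smul, Real.norm_eq_abs, TypeIRate.norm_exp_smul_skew hB]

/-! ## §2 The profile read off its physical field -/

section Physical

variable {a : ℝ} {B : EuclideanSpace ℝ (Fin 3) →L[ℝ] EuclideanSpace ℝ (Fin 3)}
  {U : EuclideanSpace ℝ (Fin 3) → EuclideanSpace ℝ (Fin 3)}
  {u : ℝ → EuclideanSpace ℝ (Fin 3) → EuclideanSpace ℝ (Fin 3)}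

/-- **The profile read off its physical field**: for `t < 0`,
`U(y) = λ⁻¹ e^{−θB} u(t, λ⁻¹ e^{θB} y)`. [folklore] -/
theorem profile_eq_of_physicalField (ha : 0 < a)
    (hu : ∀ (t : ℝ) (x : EuclideanSpace ℝ (Fin 3)), u t x =
      (Real.sqrt (2 * a * (0 - t)))⁻¹ • (NormedSpace.exp ((a⁻¹ * Real.log (Real.sqrt (2 * a * (0 - t)))⁻¹) • B))
        (U ((Real.sqrt (2 * a * (0 - t)))⁻¹ •
          (NormedSpace.exp ((-(a⁻¹ * Real.log (Real.sqrt (2 * a * (0 - t)))⁻¹)) • B)) x)))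
    {t : ℝ} (ht : t < 0) (y : EuclideanSpace ℝ (Fin 3)) :
    U y = (((Real.sqrt (2 * a * (0 - t)))⁻¹)⁻¹ •
        NormedSpace.exp ((-(a⁻¹ * Real.log (Real.sqrt (2 * a * (0 - t)))⁻¹)) • B))
      (u t ((((Real.sqrt (2 * a * (0 - t)))⁻¹)⁻¹ •
        NormedSpace.exp ((a⁻¹ * Real.log (Real.sqrt (2 * a * (0 - t)))⁻¹) • B)) y + 0)) := by
  set lam : ℝ := (Real.sqrt (2 * a * (0 - t)))⁻¹ with hlam
  set θ : ℝ := a⁻¹ * Real.log lam with hθ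
  have hlam0 : 0 < lam := inv_pos.2 (Real.sqrt_pos.2 (by nlinarith))
  have h1 : ∀ v : EuclideanSpace ℝ (Fin 3), NormedSpace.exp ((-θ) • B) (NormedSpace.exp (θ • B) v) = v := fun v => by
    have h := TypeIRate.flow_flow_neg B v (-θ)
    rwa [neg_neg] at h
  have h2 : u t (lam⁻¹ • NormedSpace.exp (θ • B) y) = lam • NormedSpace.exp (θ • B) (U y) := by
    rw [hu t, ← hlam, ← hθ, map_smul, smul_smul, mul_inv_cancel₀ hlam0.ne', one_smul, h1]
  rw [add_zero]
  show U y = lam⁻¹ • NormedSpace.exp ((-θ) • B) (u t (lam⁻¹ • NormedSpace.exp (θ • B) y))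
  rw [h2, map_smul, smul_smul, inv_mul_cancel₀ hlam0.ne', one_smul, h1]

/-- **Derivatives of the profile from derivatives of the physical field**: for `t < 0`, `i ≤ n` and `u(t) ∈ Cⁿ`,
`‖DⁱU(y)‖ ≤ λ⁻¹ (λ⁻¹)ⁱ ‖Dⁱu(t)(λ⁻¹ e^{θB} y)‖`. [folklore] -/
theorem norm_iteratedFDeriv_profile_le (ha : 0 < a) (hB : ∀ x, inner ℝ (B x) x = 0)
    (hu : ∀ (t : ℝ) (x : EuclideanSpace ℝ (Fin 3)), u t x =
      (Real.sqrt (2 * a * (0 - t)))⁻¹ • (NormedSpace.exp ((a⁻¹ * Real.log (Real.sqrt (2 * a * (0 - t)))⁻¹) • B))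
        (U ((Real.sqrt (2 * a * (0 - t)))⁻¹ •
          (NormedSpace.exp ((-(a⁻¹ * Real.log (Real.sqrt (2 * a * (0 - t)))⁻¹)) • B)) x)))
    {t : ℝ} (ht : t < 0) {n : ℕ} (hut : ContDiff ℝ n (u t)) {i : ℕ} (hi : i ≤ n) (y : EuclideanSpace ℝ (Fin 3)) :
    ‖iteratedFDeriv ℝ i U y‖ ≤
      ((Real.sqrt (2 * a * (0 - t)))⁻¹)⁻¹ * (((Real.sqrt (2 * a * (0 - t)))⁻¹)⁻¹) ^ i *
        ‖iteratedFDeriv ℝ i (u t) ((((Real.sqrt (2 * a * (0 - t)))⁻¹)⁻¹ •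
          NormedSpace.exp ((a⁻¹ * Real.log (Real.sqrt (2 * a * (0 - t)))⁻¹) • B)) y)‖ := by
  set lam : ℝ := (Real.sqrt (2 * a * (0 - t)))⁻¹ with hlam
  set θ : ℝ := a⁻¹ * Real.log lam with hθ
  have hlam0 : 0 < lam := inv_pos.2 (Real.sqrt_pos.2 (by nlinarith))
  set L : EuclideanSpace ℝ (Fin 3) →L[ℝ] EuclideanSpace ℝ (Fin 3) := lam⁻¹ • NormedSpace.exp ((-θ) • B) with hL
  set A : EuclideanSpace ℝ (Fin 3) →L[ℝ] EuclideanSpace ℝ (Fin 3) := lam⁻¹ • NormedSpace.exp (θ • B) with hA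
  have hUeq : U = fun y => L (u t (A y + 0)) := by
    funext y
    have h := profile_eq_of_physicalField ha hu ht y
    rw [← hlam, ← hθ] at h
    exact h
  have hLn : ‖L‖ ≤ lam⁻¹ := (opNorm_smul_exp_le hB _ _).trans (le_of_eq (abs_of_pos (inv_pos.2 hlam0)))
  have hAn : ‖A‖ ≤ lam⁻¹ := (opNorm_smul_exp_le hB _ _).trans (le_of_eq (abs_of_pos (inv_pos.2 hlam0)))
  have h := norm_iteratedFDeriv_comp_affine_le hut L A 0 hi y
  rw [← hUeq] at h
  refine h.trans ?_
  rw [add_zero]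
  have e : (A y : EuclideanSpace ℝ (Fin 3)) = lam⁻¹ • NormedSpace.exp (θ • B) y := rfl
  rw [e]
  refine mul_le_mul_of_nonneg_right ?_ (norm_nonneg _)
  exact mul_le_mul hLn (pow_le_pow_left₀ (norm_nonneg _) hAn i) (by positivity) (by positivity)

end Physical

/-! ## §3 Derivative decay under the symmetries of the profile system -/

section Transfers

variable {V W : EuclideanSpace ℝ (Fin 3) → EuclideanSpace ℝ (Fin 3)}

/-- **Translation**: if `‖DV(z)‖ ≤ C/‖z‖²` and `‖D²V(z)‖ ≤ C/‖z‖³` for `‖z‖ ≥ R₀`, then `W(y) = V(y − y₀) + b` has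
`‖DW(y)‖ ≤ 4C/‖y‖²` and `‖D²W(y)‖ ≤ 8C/‖y‖³` for `‖y‖ ≥ 2(R₀ + ‖y₀‖)`. [folklore] -/
theorem derivDecay_translate (hV : ContDiff ℝ 2 V) {C R₀ : ℝ} (hC : 0 ≤ C) (hR₀ : 0 ≤ R₀)
    (h1 : ∀ z, R₀ ≤ ‖z‖ → ‖fderiv ℝ V z‖ ≤ C / ‖z‖ ^ 2)
    (h2 : ∀ z, R₀ ≤ ‖z‖ → ‖iteratedFDeriv ℝ 2 V z‖ ≤ C / ‖z‖ ^ 3)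
    (y₀ b : EuclideanSpace ℝ (Fin 3)) (hW : ∀ y, W y = V (y - y₀) + b) :
    (∀ y, 2 * (R₀ + ‖y₀‖) + 1 ≤ ‖y‖ → ‖fderiv ℝ W y‖ ≤ 4 * C / ‖y‖ ^ 2) ∧
      (∀ y, 2 * (R₀ + ‖y₀‖) + 1 ≤ ‖y‖ → ‖iteratedFDeriv ℝ 2 W y‖ ≤ 8 * C / ‖y‖ ^ 3) := by
  have hWf : W = fun y => V (y - y₀) + b := funext hW
  have key : ∀ y, 2 * (R₀ + ‖y₀‖) + 1 ≤ ‖y‖ → R₀ ≤ ‖y - y₀‖ ∧ ‖y‖ ≤ 2 * ‖y - y₀‖ ∧ 0 < ‖y - y₀‖ := by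
    intro y hy
    have h := norm_sub_norm_le y y₀
    have h' : ‖y‖ - ‖y₀‖ ≤ ‖y - y₀‖ := by linarith [abs_le.1 (abs_norm_sub_norm_le y y₀)]
    refine ⟨by linarith [norm_nonneg y₀], by linarith [norm_nonneg y₀], by linarith [norm_nonneg y₀]⟩
  have hderiv : ∀ (n : ℕ), 1 ≤ n → n ≤ 2 → ∀ y, iteratedFDeriv ℝ n W y = iteratedFDeriv ℝ n V (y - y₀) := by
    intro n hn1 hn2 y
    rw [hWf]
    have hV' : ContDiff ℝ 2 (fun y => V (y - y₀)) := hV.comp (contDiff_id.sub contDiff_const)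
    have e : (fun y => V (y - y₀) + b) = (fun y => V (y - y₀)) + fun _ => b := rfl
    rw [e, iteratedFDeriv_add_apply (hV'.contDiffAt.of_le (by exact_mod_cast hn2)) contDiffAt_const,
      iteratedFDeriv_const_of_ne (by omega), Pi.zero_apply, add_zero, iteratedFDeriv_comp_sub]
  refine ⟨fun y hy => ?_, fun y hy => ?_⟩
  · obtain ⟨hz, hyz, hz0⟩ := key y hy
    have hy0 : 0 < ‖y‖ := by linarith [norm_nonneg y₀]
    rw [← norm_iteratedFDeriv_one, hderiv 1 le_rfl (by norm_num), norm_iteratedFDeriv_one]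
    refine (h1 _ hz).trans ?_
    rw [div_le_div_iff₀ (by positivity) (by positivity)]
    nlinarith [pow_le_pow_left₀ hy0.le hyz 2]
  · obtain ⟨hz, hyz, hz0⟩ := key y hy
    have hy0 : 0 < ‖y‖ := by linarith [norm_nonneg y₀]
    rw [hderiv 2 (by norm_num) le_rfl]
    refine (h2 _ hz).trans ?_
    rw [div_le_div_iff₀ (by positivity) (by positivity)]
    nlinarith [pow_le_pow_left₀ hy0.le hyz 3]

/-- **Dilation**: if `‖DW(z)‖ ≤ C/‖z‖²` and `‖D²W(z)‖ ≤ C/‖z‖³` for `‖z‖ ≥ R₀` and `W ∈ C²`, then `U(y) = k W(c y)` (`c > 0`)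
has `‖DU(y)‖ ≤ |k|c⁻¹C/‖y‖²` and `‖D²U(y)‖ ≤ |k|c⁻¹C/‖y‖³` for `‖y‖ ≥ R₀/c`. [folklore] -/
theorem derivDecay_dilate {U : EuclideanSpace ℝ (Fin 3) → EuclideanSpace ℝ (Fin 3)} (hW : ContDiff ℝ 2 W)
    {C R₀ : ℝ} (hR₀ : 0 < R₀)
    (h1 : ∀ z, R₀ ≤ ‖z‖ → ‖fderiv ℝ W z‖ ≤ C / ‖z‖ ^ 2)
    (h2 : ∀ z, R₀ ≤ ‖z‖ → ‖iteratedFDeriv ℝ 2 W z‖ ≤ C / ‖z‖ ^ 3)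
    {k c : ℝ} (hc : 0 < c) (hU : ∀ y, U y = k • W (c • y)) :
    (∀ y, R₀ / c ≤ ‖y‖ → ‖fderiv ℝ U y‖ ≤ |k| * c⁻¹ * C / ‖y‖ ^ 2) ∧
      (∀ y, R₀ / c ≤ ‖y‖ → ‖iteratedFDeriv ℝ 2 U y‖ ≤ |k| * c⁻¹ * C / ‖y‖ ^ 3) := by
  set L : EuclideanSpace ℝ (Fin 3) →L[ℝ] EuclideanSpace ℝ (Fin 3) :=
    k • (1 : EuclideanSpace ℝ (Fin 3) →L[ℝ] EuclideanSpace ℝ (Fin 3)) with hL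
  set A : EuclideanSpace ℝ (Fin 3) →L[ℝ] EuclideanSpace ℝ (Fin 3) :=
    c • (1 : EuclideanSpace ℝ (Fin 3) →L[ℝ] EuclideanSpace ℝ (Fin 3)) with hA
  have hLv : ∀ v : EuclideanSpace ℝ (Fin 3), L v = k • v := fun v => rfl
  have hAv : ∀ v : EuclideanSpace ℝ (Fin 3), A v = c • v := fun v => rfl
  have hUf : U = fun y => L (W (A y + 0)) := by
    funext y; rw [hU y, add_zero, hLv, hAv]
  have hLn : ‖L‖ ≤ |k| := by
    refine ContinuousLinearMap.opNorm_le_bound _ (abs_nonneg _) fun v => ?_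
    rw [hLv, norm_smul, Real.norm_eq_abs]
  have hAn : ‖A‖ ≤ c := by
    refine ContinuousLinearMap.opNorm_le_bound _ hc.le fun v => ?_
    rw [hAv, norm_smul, Real.norm_of_nonneg hc.le]
  have key : ∀ y : EuclideanSpace ℝ (Fin 3), R₀ / c ≤ ‖y‖ → R₀ ≤ ‖c • y‖ ∧ 0 < ‖y‖ := by
    intro y hy
    have hy0 : 0 < ‖y‖ := lt_of_lt_of_le (div_pos hR₀ hc) hy
    refine ⟨?_, hy0⟩
    rw [norm_smul, Real.norm_of_nonneg hc.le]
    rwa [div_le_iff₀' hc] at hy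
  have hbound : ∀ (i : ℕ), i ≤ 2 → ∀ y, ‖iteratedFDeriv ℝ i U y‖ ≤ |k| * c ^ i * ‖iteratedFDeriv ℝ i W (c • y)‖ := by
    intro i hi y
    have h := norm_iteratedFDeriv_comp_affine_le hW L A 0 hi y
    rw [← hUf, add_zero, hAv] at h
    refine h.trans ?_
    refine mul_le_mul_of_nonneg_right ?_ (norm_nonneg _)
    exact mul_le_mul hLn (pow_le_pow_left₀ (norm_nonneg _) hAn i) (by positivity) (abs_nonneg _)
  refine ⟨fun y hy => ?_, fun y hy => ?_⟩
  · obtain ⟨hz, hy0⟩ := key y hy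
    rw [← norm_iteratedFDeriv_one]
    refine (hbound 1 (by norm_num) y).trans ?_
    rw [norm_iteratedFDeriv_one]
    refine (mul_le_mul_of_nonneg_left (h1 _ hz) (by positivity)).trans (le_of_eq ?_)
    rw [norm_smul, Real.norm_of_nonneg hc.le]
    field_simp
  · obtain ⟨hz, hy0⟩ := key y hy
    refine (hbound 2 le_rfl y).trans ?_
    refine (mul_le_mul_of_nonneg_left (h2 _ hz) (by positivity)).trans (le_of_eq ?_)
    rw [norm_smul, Real.norm_of_nonneg hc.le]
    field_simp

/-- **The `ε`–`R` form of K1a** from the two decay bounds. [folklore] -/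
theorem scaleNaturalDecay_of_derivDecay {U : EuclideanSpace ℝ (Fin 3) → EuclideanSpace ℝ (Fin 3)} {C₁ C₂ R₀ : ℝ}
    (hR₀ : 0 < R₀)
    (h1 : ∀ y, R₀ ≤ ‖y‖ → ‖fderiv ℝ U y‖ ≤ C₁ / ‖y‖ ^ 2)
    (h2 : ∀ y, R₀ ≤ ‖y‖ → ‖iteratedFDeriv ℝ 2 U y‖ ≤ C₂ / ‖y‖ ^ 3) :
    ∀ ε : ℝ, 0 < ε → ∃ R : ℝ, ∀ y, R ≤ ‖y‖ →
      ‖y‖ * ‖fderiv ℝ U y‖ + ‖y‖ ^ 2 * ‖iteratedFDeriv ℝ 2 U y‖ ≤ ε := by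
  intro ε hε
  refine ⟨max R₀ ((C₁ + C₂) / ε + 1), fun y hy => ?_⟩
  have hyR : R₀ ≤ ‖y‖ := (le_max_left _ _).trans hy
  have hy0 : 0 < ‖y‖ := hR₀.trans_le hyR
  have hyε : (C₁ + C₂) / ε < ‖y‖ := by linarith [le_max_right R₀ ((C₁ + C₂) / ε + 1)]
  have hb1 : ‖y‖ * ‖fderiv ℝ U y‖ ≤ C₁ / ‖y‖ := by
    calc ‖y‖ * ‖fderiv ℝ U y‖ ≤ ‖y‖ * (C₁ / ‖y‖ ^ 2) := mul_le_mul_of_nonneg_left (h1 y hyR) hy0.le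
      _ = C₁ / ‖y‖ := by field_simp
  have hb2 : ‖y‖ ^ 2 * ‖iteratedFDeriv ℝ 2 U y‖ ≤ C₂ / ‖y‖ := by
    calc ‖y‖ ^ 2 * ‖iteratedFDeriv ℝ 2 U y‖ ≤ ‖y‖ ^ 2 * (C₂ / ‖y‖ ^ 3) :=
          mul_le_mul_of_nonneg_left (h2 y hyR) (by positivity)
      _ = C₂ / ‖y‖ := by field_simp
  have hsum : C₁ / ‖y‖ + C₂ / ‖y‖ ≤ ε := by
    rw [← add_div, div_le_iff₀ hy0]
    have := (div_lt_iff₀ hε).1 hyε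
    nlinarith
  linarith

end Transfers

end ScaleNaturalDecay

end Summit.NavierStokesRegularity.NavierStokesRegularity.Theorems.CoriolisHead

end
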